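import Summits.KontsevichZagierPeriods.Zeta5Search.Barrier.ConeGammaS7CritCoords
import Summits.KontsevichZagierPeriods.Zeta5Search.Barrier.ConeGammaS7CritSwapCore

/-!
# ζ(5) search — BARRIER: the critical-value cocycle for the `S₇` generator `s₅ ↔ s₆` (pointwise form)

HONEST FRAMING (cell `pub-zeta5`): systematic search; no irrationality claim unless kernel-certified. MODEL objects
under Brown–Zudilin's (28)+(30) accounting ([BZ22] = arXiv:2210.03391; (28) observed, not proved); a statement
about BZ's §5 critical system and growth functional under the hypergeometric group; nothing here is about the size
of any critical value, the cone's supremum (C2 = `BarrierC2`, OPEN), S-E (CONJECTURED) or `ζ(5)`. No number or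
sentence of record moves. Records in print UNMOVED. Prover P2 g21 (self-selected Lean-only item, file 3).

**`isCritical_growthLogR_swap45`.** Let `a = aOfS s` with `s₅ ≠ s₀`, `s₆ ≠ s₀` and `s₃+s₅, s₃+s₆, s₄+s₅, s₄+s₆ ≠ 0`
(all automatic on the open box), and let `(x, y)` be a critical point of `a` (`IsCritical`: `F₁ = F₂ = 0`, twelve
factors non-zero). Put `y′ = y − s₆ + s₅` and let `x′` be the MÖBIUS IMAGE: the solution of the (linear) relation
`(x′ + y − s₅ − s₆)·Q₅ = (s₅ − s₀)·P`, `P = (y−p₆)(y−p₅)(y−p₄)`, `Q₅ = (y−s₆+s₅)(p₄+q₄−y)(p₅+q₅−y) − P`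
(it exists iff `Q₅ ≠ 0`). IF the image is not BZ's trivial solution, i.e. `y′ ≠ 0`, THEN `(x′, y′)` is a critical
point of the swapped direction `a′ = aOfS ((56)·s) = (56)·a` and
`growthLogR(a′)(x′, y′) = growthLogR(a)(x, y) + ΔE((56); a)`, `ΔE = Σ_{i∈F}[h_i(a′) log h_i(a′) − h_i(a) log h_i(a)]`
(the F-entropy cocycle of `ConeGammaS7Cocycle.phi30_permAct`). Corollaries: `isCritical_swap45`,
`growthLogR_swap45`, `mem_critVals_swap45` (`v ∈ critVals a` from such a point ⇒ `v + ΔE ∈ critVals ((56)·a)`).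
The two excluded cases (`Q₅ = 0`: image at infinity; `y′ = 0`: image = `(p₃′, 0)`) are where the set-level cocycle
FAILS (file `ConeGammaS7CritOrbit`, with an explicit rational witness inside the cone); nothing is claimed there.
Proof: `ConeGammaS7CritSwapCore` (resolvent identity, five product identities, non-degeneracy) + logarithms.
-/

noncomputable section

open Finset

namespace Summit.KontsevichZagierPeriods.Zeta5Search.Barrier.ConeGamma

/-- `log` of a three-factor product identity. -/
theorem log_eq_of_mul3_eq {a b c d e f : ℝ} (ha : a ≠ 0) (hb : b ≠ 0) (hc : c ≠ 0) (hd : d ≠ 0) (he : e ≠ 0)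
    (hf : f ≠ 0) (h : a * b * c = d * e * f) :
    Real.log a + Real.log b + Real.log c = Real.log d + Real.log e + Real.log f := by
  have := congrArg Real.log h
  rwa [Real.log_mul (mul_ne_zero ha hb) hc, Real.log_mul ha hb, Real.log_mul (mul_ne_zero hd he) hf,
    Real.log_mul hd he] at this

/-- `log` of a four-factor product identity. -/
theorem log_eq_of_mul4_eq {a b c d e f g h : ℝ} (ha : a ≠ 0) (hb : b ≠ 0) (hc : c ≠ 0) (hd : d ≠ 0) (he : e ≠ 0)
    (hf : f ≠ 0) (hg : g ≠ 0) (hh : h ≠ 0) (hyp : a * b * c * d = e * f * g * h) :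
    Real.log a + Real.log b + Real.log c + Real.log d = Real.log e + Real.log f + Real.log g + Real.log h := by
  have := congrArg Real.log hyp
  rwa [Real.log_mul (mul_ne_zero (mul_ne_zero ha hb) hc) hd, Real.log_mul (mul_ne_zero ha hb) hc,
    Real.log_mul ha hb, Real.log_mul (mul_ne_zero (mul_ne_zero he hf) hg) hh, Real.log_mul (mul_ne_zero he hf) hg,
    Real.log_mul he hf] at this

/-- **The critical-value cocycle for the generator `s₅ ↔ s₆`, pointwise.** See the module docstring. -/
theorem isCritical_growthLogR_swap45 {s : Fin 8 → ℝ} {x y x' : ℝ} (h05 : s 5 ≠ s 0) (h06 : s 6 ≠ s 0)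
    (h35 : s 3 + s 5 ≠ 0) (h36 : s 3 + s 6 ≠ 0) (h45 : s 4 + s 5 ≠ 0) (h46 : s 4 + s 6 ≠ 0)
    (hc : IsCritical (aOfS s) x y) (hy5 : y - s 6 + s 5 ≠ 0)
    (hx' : (x' + y - s 5 - s 6) * ((y - s 6 + s 5) * ((s 1 + s 2 + s 6 + s 7 - y) * (s 0 + s 6 - y))
        - (y - (s 1 + s 6)) * (y - (s 2 + s 6)) * (y - (s 6 + s 7)))
      = (s 5 - s 0) * ((y - (s 1 + s 6)) * (y - (s 2 + s 6)) * (y - (s 6 + s 7)))) :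
    IsCritical (aOfS (permS (Equiv.swap 4 5) s)) x' (y - s 6 + s 5)
    ∧ growthLogR (pR (aOfS (permS (Equiv.swap 4 5) s))) (qR (aOfS (permS (Equiv.swap 4 5) s))) x' (y - s 6 + s 5)
      = growthLogR (pR (aOfS s)) (qR (aOfS s)) x y
        + (∑ i ∈ FIdx, h28 (aOfS (permS (Equiv.swap 4 5) s)) i * Real.log (h28 (aOfS (permS (Equiv.swap 4 5) s)) i)
          - ∑ i ∈ FIdx, h28 (aOfS s) i * Real.log (h28 (aOfS s) i)) := by
  obtain ⟨e0, e1, e2, e3, e4, e5, e6, e7⟩ := permS_swap45_apply s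
  -- unpack the critical point of `a`
  obtain ⟨hF1, hF2, hv⟩ := hc
  rw [F1R_aOfS] at hF1
  rw [F2R_aOfS] at hF2
  rw [critFactors_aOfS] at hv
  have hv0 : x - (s 4 + s 6) ≠ 0 := by simpa using hv 0
  have hv1 : x - (s 3 + s 6) ≠ 0 := by simpa using hv 1
  have hv2 : x - (s 5 + s 6) ≠ 0 := by simpa using hv 2
  have hv3 : x + y - (s 0 + s 6) ≠ 0 := by simpa using hv 3
  have hv4 : s 0 + s 6 - x ≠ 0 := by simpa using hv 4
  have hv5 : s 3 + s 4 + s 5 + s 6 - x ≠ 0 := by simpa using hv 5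
  have hv6 : x + y - 2 * s 6 ≠ 0 := by simpa using hv 6
  have hv7 : y - (s 6 + s 7) ≠ 0 := by simpa using hv 7
  have hv8 : y - (s 2 + s 6) ≠ 0 := by simpa using hv 8
  have hv9 : y - (s 1 + s 6) ≠ 0 := by simpa using hv 9
  have hv10 : s 1 + s 2 + s 6 + s 7 - y ≠ 0 := by simpa using hv 10
  have hv11 : s 0 + s 6 - y ≠ 0 := by simpa using hv 11
  have hy0 : y ≠ 0 := by
    intro h0
    apply mul_ne_zero (mul_ne_zero (mul_ne_zero hv3 hv7) hv8) hv9
    calc (x + y - (s 0 + s 6)) * (y - (s 6 + s 7)) * (y - (s 2 + s 6)) * (y - (s 1 + s 6))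
        = (x + y - 2 * s 6) * (s 1 + s 2 + s 6 + s 7 - y) * (s 0 + s 6 - y) * y := by linear_combination -hF2
      _ = 0 := by rw [h0, mul_zero]
  -- hypotheses of the core lemmas (shifted coordinates `X = x − s₆`, `Y = y − s₆`, `X′ = x′ − s₅`)
  have hF1c : (x - s 6 + s 6) * (s 0 - (x - s 6)) * (s 3 + s 4 + s 5 - (x - s 6)) * (x - s 6 + (y - s 6))
      - (x - s 6 - s 3) * (x - s 6 - s 4) * (x - s 6 - s 5) * (x - s 6 + (y - s 6) + s 6 - s 0) = 0 := by
    linear_combination hF1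
  have hF2c : (y - s 6 + s 6) * (s 1 + s 2 + s 7 - (y - s 6)) * (s 0 - (y - s 6)) * (x - s 6 + (y - s 6))
      - (x - s 6 + (y - s 6) + s 6 - s 0) * (y - s 6 - s 1) * (y - s 6 - s 2) * (y - s 6 - s 7) = 0 := by
    linear_combination hF2
  have hPc : (y - s 6 - s 1) * (y - s 6 - s 2) * (y - s 6 - s 7) ≠ 0 := by
    have e : (y - s 6 - s 1) * (y - s 6 - s 2) * (y - s 6 - s 7)
        = (y - (s 1 + s 6)) * (y - (s 2 + s 6)) * (y - (s 6 + s 7)) := by ring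
    rw [e]; exact mul_ne_zero (mul_ne_zero hv9 hv8) hv7
  have hMc : (s 1 + s 2 + s 7 - (y - s 6)) * (s 0 - (y - s 6)) ≠ 0 := by
    have e : (s 1 + s 2 + s 7 - (y - s 6)) * (s 0 - (y - s 6)) = (s 1 + s 2 + s 6 + s 7 - y) * (s 0 + s 6 - y) := by
      ring
    rw [e]; exact mul_ne_zero hv10 hv11
  have hy6 : y - s 6 + s 6 ≠ 0 := by rw [sub_add_cancel]; exact hy0
  have hX'c : (x' - s 5 + (y - s 6)) * ((y - s 6 + s 5) * ((s 1 + s 2 + s 7 - (y - s 6)) * (s 0 - (y - s 6)))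
        - (y - s 6 - s 1) * (y - s 6 - s 2) * (y - s 6 - s 7))
      = (s 5 - s 0) * ((y - s 6 - s 1) * (y - s 6 - s 2) * (y - s 6 - s 7)) := by
    linear_combination hx'
  have hv0c : x - s 6 - s 4 ≠ 0 := fun h => hv0 (by linear_combination h)
  have hv1c : x - s 6 - s 3 ≠ 0 := fun h => hv1 (by linear_combination h)
  have hv2c : x - s 6 - s 5 ≠ 0 := fun h => hv2 (by linear_combination h)
  have hv3c : x - s 6 + (y - s 6) + s 6 - s 0 ≠ 0 := fun h => hv3 (by linear_combination h)
  have hv4c : s 0 - (x - s 6) ≠ 0 := fun h => hv4 (by linear_combination h)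
  have hv5c : s 3 + s 4 + s 5 - (x - s 6) ≠ 0 := fun h => hv5 (by linear_combination h)
  have hy5c : y - s 6 + s 5 ≠ 0 := hy5
  -- the core: transfer of the system, the five product identities, non-degeneracy
  have hF1n := swap_F1_transfer hF1c hF2c h06 h05 hPc hy6 hX'c
  have hF2n := swap_F2_transfer hX'c
  obtain ⟨g0, g3, g4, g5, g6⟩ := swap_group_identities hF1c hF2c h06 h05 hPc hy6 hX'c
  obtain ⟨n0, n1, n2, n3, n4, n5, n6, nx'⟩ :=
    swap_newFactors_ne_zero hF1c hF2c h06 h05 hPc hy6 hX'c hMc hv0c hv1c hv2c hv3c hv4c hv5c h35 h36 h45 h46 hy5c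
  -- the new factors in the printed coordinates
  have m0 : x' - (s 4 + s 5) ≠ 0 := fun h => n0 (by linear_combination h)
  have m1 : x' - (s 3 + s 5) ≠ 0 := fun h => n1 (by linear_combination h)
  have m2 : x' - (s 6 + s 5) ≠ 0 := fun h => n2 (by linear_combination h)
  have m3 : x' + (y - s 6 + s 5) - (s 0 + s 5) ≠ 0 := fun h => n3 (by linear_combination h)
  have m4 : s 0 + s 5 - x' ≠ 0 := fun h => n4 (by linear_combination h)
  have m5 : s 3 + s 4 + s 6 + s 5 - x' ≠ 0 := fun h => n5 (by linear_combination h)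
  have m6 : x' + (y - s 6 + s 5) - 2 * s 5 ≠ 0 := fun h => n6 (by linear_combination h)
  have m7 : y - s 6 + s 5 - (s 5 + s 7) ≠ 0 := fun h => hv7 (by linear_combination h)
  have m8 : y - s 6 + s 5 - (s 2 + s 5) ≠ 0 := fun h => hv8 (by linear_combination h)
  have m9 : y - s 6 + s 5 - (s 1 + s 5) ≠ 0 := fun h => hv9 (by linear_combination h)
  have m10 : s 1 + s 2 + s 5 + s 7 - (y - s 6 + s 5) ≠ 0 := fun h => hv10 (by linear_combination h)
  have m11 : s 0 + s 5 - (y - s 6 + s 5) ≠ 0 := fun h => hv11 (by linear_combination h)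
  refine ⟨?_, ?_⟩
  · -- `IsCritical (a′) x′ y′`
    refine ⟨?_, ?_, ?_⟩
    · rw [F1R_aOfS]; simp only [e0, e3, e4, e5, e6]; linear_combination hF1n
    · rw [F2R_aOfS]; simp only [e0, e1, e2, e6, e7]; linear_combination hF2n
    · rw [critFactors_aOfS]; simp only [e0, e1, e2, e3, e4, e5, e6, e7]
      intro k; fin_cases k
      · simpa using m0
      · simpa using m1
      · simpa using m2
      · simpa using m3
      · simpa using m4
      · simpa using m5
      · simpa using m6
      · simpa using m7
      · simpa using m8
      · simpa using m9
      · simpa using m10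
      · simpa using m11
  · -- the growth shift
    rw [growthLogR_aOfS, growthLogR_aOfS, sum_FIdx_mul_log_aOfS, sum_FIdx_mul_log_aOfS]
    simp only [e0, e1, e2, e3, e4, e5, e6, e7]
    have hx0 : x ≠ 0 := by
      intro h0
      apply mul_ne_zero (mul_ne_zero (mul_ne_zero hv0 hv1) hv2) hv3
      calc (x - (s 4 + s 6)) * (x - (s 3 + s 6)) * (x - (s 5 + s 6)) * (x + y - (s 0 + s 6))
          = x * (s 0 + s 6 - x) * (s 3 + s 4 + s 5 + s 6 - x) * (x + y - 2 * s 6) := by linear_combination -hF1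
        _ = 0 := by rw [h0]; ring
    have hx'0 : x' ≠ 0 := by simpa using nx'
    have h05' : s 0 - s 5 ≠ 0 := fun h => h05 (by linear_combination -h)
    have h06' : s 0 - s 6 ≠ 0 := fun h => h06 (by linear_combination -h)
    -- the product identities in the printed coordinates
    have pg0 : (x' + (y - s 6 + s 5) - (s 0 + s 5)) * (s 0 + s 6 - x) * (s 0 - s 6)
        = (s 0 + s 5 - x') * (x + y - (s 0 + s 6)) * (s 0 - s 5) := by linear_combination g0
    have pg3 : (x' - (s 3 + s 5)) * (s 3 + s 4 + s 5 + s 6 - x) * (s 3 + s 6)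
        = (s 3 + s 4 + s 6 + s 5 - x') * (x - (s 3 + s 6)) * (s 3 + s 5) := by linear_combination g3
    have pg4 : (x' - (s 4 + s 5)) * (s 3 + s 4 + s 5 + s 6 - x) * (s 4 + s 6)
        = (s 3 + s 4 + s 6 + s 5 - x') * (x - (s 4 + s 6)) * (s 4 + s 5) := by linear_combination g4
    have pg5 : x' * ((y - (s 1 + s 6)) * (y - (s 2 + s 6)) * (y - (s 6 + s 7))) * (s 3 + s 4 + s 5 + s 6 - x)
          * (s 0 - s 5)
        = (x' + (y - s 6 + s 5) - 2 * s 5) * ((s 1 + s 2 + s 6 + s 7 - y) * (s 0 + s 6 - y)) * (x - (s 5 + s 6))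
          * ((s 3 + s 5) * (s 4 + s 5)) := by linear_combination g5
    have pg6 : x * ((y - (s 1 + s 6)) * (y - (s 2 + s 6)) * (y - (s 6 + s 7))) * (s 3 + s 4 + s 6 + s 5 - x')
          * (s 0 - s 6)
        = (x + y - 2 * s 6) * ((s 1 + s 2 + s 6 + s 7 - y) * (s 0 + s 6 - y)) * (x' - (s 6 + s 5))
          * ((s 3 + s 6) * (s 4 + s 6)) := by linear_combination g6
    have pR1 : x * (s 0 + s 6 - x) * (s 3 + s 4 + s 5 + s 6 - x) * (x + y - 2 * s 6)
        = (x - (s 4 + s 6)) * (x - (s 3 + s 6)) * (x - (s 5 + s 6)) * (x + y - (s 0 + s 6)) := by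
      linear_combination hF1
    have pR1' : x' * (s 0 + s 5 - x') * (s 3 + s 4 + s 6 + s 5 - x') * (x' + (y - s 6 + s 5) - 2 * s 5)
        = (x' - (s 4 + s 5)) * (x' - (s 3 + s 5)) * (x' - (s 6 + s 5)) * (x' + (y - s 6 + s 5) - (s 0 + s 5)) := by
      linear_combination hF1n
    have hP3 : (y - (s 1 + s 6)) * (y - (s 2 + s 6)) * (y - (s 6 + s 7)) ≠ 0 := mul_ne_zero (mul_ne_zero hv9 hv8) hv7
    have hM2 : (s 1 + s 2 + s 6 + s 7 - y) * (s 0 + s 6 - y) ≠ 0 := mul_ne_zero hv10 hv11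
    -- logarithms
    have LG0 := log_eq_of_mul3_eq m3 hv4 h06' m4 hv3 h05' pg0
    have LG3 := log_eq_of_mul3_eq m1 hv5 h36 m5 hv1 h35 pg3
    have LG4 := log_eq_of_mul3_eq m0 hv5 h46 m5 hv0 h45 pg4
    have LG5 := log_eq_of_mul4_eq hx'0 hP3 hv5 h05' m6 hM2 hv2 (mul_ne_zero h35 h45) pg5
    have LG6 := log_eq_of_mul4_eq hx0 hP3 m5 h06' hv6 hM2 m2 (mul_ne_zero h36 h46) pg6
    have LR1 := log_eq_of_mul4_eq hx0 hv4 hv5 hv6 hv0 hv1 hv2 hv3 pR1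
    have LR1' := log_eq_of_mul4_eq hx'0 m4 m5 m6 m0 m1 m2 m3 pR1'
    have lP : Real.log ((y - (s 1 + s 6)) * (y - (s 2 + s 6)) * (y - (s 6 + s 7)))
        = Real.log (y - (s 1 + s 6)) + Real.log (y - (s 2 + s 6)) + Real.log (y - (s 6 + s 7)) := by
      rw [Real.log_mul (mul_ne_zero hv9 hv8) hv7, Real.log_mul hv9 hv8]
    have lM : Real.log ((s 1 + s 2 + s 6 + s 7 - y) * (s 0 + s 6 - y))
        = Real.log (s 1 + s 2 + s 6 + s 7 - y) + Real.log (s 0 + s 6 - y) := Real.log_mul hv10 hv11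
    have lC5 : Real.log ((s 3 + s 5) * (s 4 + s 5)) = Real.log (s 3 + s 5) + Real.log (s 4 + s 5) :=
      Real.log_mul h35 h45
    have lC6 : Real.log ((s 3 + s 6) * (s 4 + s 6)) = Real.log (s 3 + s 6) + Real.log (s 4 + s 6) :=
      Real.log_mul h36 h46
    rw [lP, lM, lC5] at LG5
    rw [lP, lM, lC6] at LG6
    -- syntactic bridges between the `y′`- and `y`-forms of the unchanged factors
    have hB7 : Real.log (y - s 6 + s 5 - (s 5 + s 7)) = Real.log (y - (s 6 + s 7)) := by congr 1; ring
    have hB8 : Real.log (y - s 6 + s 5 - (s 2 + s 5)) = Real.log (y - (s 2 + s 6)) := by congr 1; ring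
    have hB9 : Real.log (y - s 6 + s 5 - (s 1 + s 5)) = Real.log (y - (s 1 + s 6)) := by congr 1; ring
    have hB10 : Real.log (s 1 + s 2 + s 5 + s 7 - (y - s 6 + s 5)) = Real.log (s 1 + s 2 + s 6 + s 7 - y) := by
      congr 1; ring
    have hB11 : Real.log (s 0 + s 5 - (y - s 6 + s 5)) = Real.log (s 0 + s 6 - y) := by congr 1; ring
    have hL65 : Real.log (s 6 + s 5) = Real.log (s 5 + s 6) := by rw [add_comm]
    linear_combination (s 0) * LG0 + (s 3) * LG3 + (s 4) * LG4 + (s 5) * LG5 - (s 6) * LG6 - (s 5) * LR1'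
      + (s 6) * LR1 + (s 5 + s 7) * hB7 + (s 2 + s 5) * hB8 + (s 1 + s 5) * hB9 - (s 1 + s 2 + s 5 + s 7) * hB10
      - (s 0 + s 5) * hB11 - (s 6 + s 5) * hL65

/-- Corollary: the Möbius image is a critical point of the swapped direction. -/
theorem isCritical_swap45 {s : Fin 8 → ℝ} {x y x' : ℝ} (h05 : s 5 ≠ s 0) (h06 : s 6 ≠ s 0)
    (h35 : s 3 + s 5 ≠ 0) (h36 : s 3 + s 6 ≠ 0) (h45 : s 4 + s 5 ≠ 0) (h46 : s 4 + s 6 ≠ 0)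
    (hc : IsCritical (aOfS s) x y) (hy5 : y - s 6 + s 5 ≠ 0)
    (hx' : (x' + y - s 5 - s 6) * ((y - s 6 + s 5) * ((s 1 + s 2 + s 6 + s 7 - y) * (s 0 + s 6 - y))
        - (y - (s 1 + s 6)) * (y - (s 2 + s 6)) * (y - (s 6 + s 7)))
      = (s 5 - s 0) * ((y - (s 1 + s 6)) * (y - (s 2 + s 6)) * (y - (s 6 + s 7)))) :
    IsCritical (aOfS (permS (Equiv.swap 4 5) s)) x' (y - s 6 + s 5) :=
  (isCritical_growthLogR_swap45 h05 h06 h35 h36 h45 h46 hc hy5 hx').1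

/-- Corollary: the growth functional shifts by the F-entropy cocycle `ΔE((56); a)`. -/
theorem growthLogR_swap45 {s : Fin 8 → ℝ} {x y x' : ℝ} (h05 : s 5 ≠ s 0) (h06 : s 6 ≠ s 0)
    (h35 : s 3 + s 5 ≠ 0) (h36 : s 3 + s 6 ≠ 0) (h45 : s 4 + s 5 ≠ 0) (h46 : s 4 + s 6 ≠ 0)
    (hc : IsCritical (aOfS s) x y) (hy5 : y - s 6 + s 5 ≠ 0)
    (hx' : (x' + y - s 5 - s 6) * ((y - s 6 + s 5) * ((s 1 + s 2 + s 6 + s 7 - y) * (s 0 + s 6 - y))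
        - (y - (s 1 + s 6)) * (y - (s 2 + s 6)) * (y - (s 6 + s 7)))
      = (s 5 - s 0) * ((y - (s 1 + s 6)) * (y - (s 2 + s 6)) * (y - (s 6 + s 7)))) :
    growthLogR (pR (aOfS (permS (Equiv.swap 4 5) s))) (qR (aOfS (permS (Equiv.swap 4 5) s))) x' (y - s 6 + s 5)
      = growthLogR (pR (aOfS s)) (qR (aOfS s)) x y
        + ∑ i ∈ FIdx, (h28 (permAct (Equiv.swap 4 5) (aOfS s)) i * Real.log (h28 (permAct (Equiv.swap 4 5) (aOfS s)) i)
          - h28 (aOfS s) i * Real.log (h28 (aOfS s) i)) := by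
  rw [entropyCocycle_aOfS]
  exact (isCritical_growthLogR_swap45 h05 h06 h35 h36 h45 h46 hc hy5 hx').2

/-- **Corollary (critical values).** Under the hypotheses of `isCritical_growthLogR_swap45`, the critical value at
`(x, y)` shifted by `ΔE((56); a)` is a critical value of `(56)·a` — for a general direction `a` (`s = sParam a`). -/
theorem mem_critVals_permAct_swap45 {a : Dir} {x y x' : ℝ} (h05 : sParam a 5 ≠ sParam a 0)
    (h06 : sParam a 6 ≠ sParam a 0) (h35 : sParam a 3 + sParam a 5 ≠ 0) (h36 : sParam a 3 + sParam a 6 ≠ 0)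
    (h45 : sParam a 4 + sParam a 5 ≠ 0) (h46 : sParam a 4 + sParam a 6 ≠ 0) (hc : IsCritical a x y)
    (hy5 : y - sParam a 6 + sParam a 5 ≠ 0)
    (hx' : (x' + y - sParam a 5 - sParam a 6) * ((y - sParam a 6 + sParam a 5)
        * ((sParam a 1 + sParam a 2 + sParam a 6 + sParam a 7 - y) * (sParam a 0 + sParam a 6 - y))
        - (y - (sParam a 1 + sParam a 6)) * (y - (sParam a 2 + sParam a 6)) * (y - (sParam a 6 + sParam a 7)))
      = (sParam a 5 - sParam a 0)
        * ((y - (sParam a 1 + sParam a 6)) * (y - (sParam a 2 + sParam a 6)) * (y - (sParam a 6 + sParam a 7)))) :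
    growthLogR (pR a) (qR a) x y
        + ∑ i ∈ FIdx, (h28 (permAct (Equiv.swap 4 5) a) i * Real.log (h28 (permAct (Equiv.swap 4 5) a) i)
          - h28 a i * Real.log (h28 a i))
      ∈ critVals (permAct (Equiv.swap 4 5) a) := by
  have hc' : IsCritical (aOfS (sParam a)) x y := by rwa [aOfS_sParam]
  have h := isCritical_growthLogR_swap45 h05 h06 h35 h36 h45 h46 hc' hy5 hx'
  rw [aOfS_sParam] at h
  refine ⟨x', y - sParam a 6 + sParam a 5, h.1, ?_⟩
  change _ = growthLogR (pR (aOfS (permS (Equiv.swap 4 5) (sParam a))))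
    (qR (aOfS (permS (Equiv.swap 4 5) (sParam a)))) x' _
  rw [h.2, Finset.sum_sub_distrib]
  rfl

end Summit.KontsevichZagierPeriods.Zeta5Search.Barrier.ConeGamma

end
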